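import Literature.NumberTheory.Sieve.IwaniecBilinearSieveBoxes
import Literature.NumberTheory.Sieve.IwaniecBilinearSieveMainTerms
import HarnessLib

/-!
# Iwaniec's bilinear linear sieve, V: comparing the box weights with Rosser's — the strips

Topic `Literature/NumberTheory/Sieve`; fifth support file for the proof of
`Literature.NumberTheory.Sieve.Iwaniec1978.lemma2_bilinearSieve` (H. Iwaniec, *A new form of the error
term in the linear sieve*, Acta Arith. 37 (1980), 307–320, Theorem 1 [IwaniecActaArith1980b]), §5 of the
paper ((30)–(33)): the main term `∑_t μ(t) χ̃(t) g(t)` of the box-truncated weights is compared with Rosser's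
`∑_t μ(t) χ(t) g(t)` (to which the explicit linear sieve applies).

* For two truncation conditions `cond ⇒ cond'` the sets differ only at numbers having a TOP SEGMENT
  `t' = p₁ ⋯ p_m` (the `m` largest primes, `m ≡ par`) with `cond' t' ∧ ¬ cond t'`
  (`BetaSieve.exists_topSeg_of_predC_of_not_predC`), whence, for multiplicative `g ≥ 0`,
  `|∑_{t ∣ P} μ(t)(χ'(t) − χ(t)) g(t)| ≤ (∑_{t' ∣ P bad} g(t')) · ∑_{s ∣ P} g(s)`
  (`BetaSieve.abs_mainSum_indC_sub_le`) — Iwaniec's (30) with the classes `C ∪ D` (there are no classes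
  `A, B` for the exact box weights used here).
* For the box conditions inside Rosser's (`β = 2`, level `D`), a bad top segment lies in the strip
  `D^{1/(1+η)} ≤ t' q(t')² < D` (`Iwaniec1980b.strip_of_bad`, from `D̂(p) ≤ p^{1+η}`), p. 318 (class `C`).

Everything is PROVED; no facts.

## References

* H. Iwaniec, *A new form of the error term in the linear sieve*, Acta Arith. 37 (1980), 307–320, §5
  (30)–(33), pp. 317–319. [IwaniecActaArith1980b]
-/

open Finset Real
open scoped ArithmeticFunction.Moebius

noncomputable section

namespace Literature.NumberTheory.Sieve

namespace BetaSieve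

variable {par : ℕ} {cond cond' : ℕ → Prop}

/-- `t' ⋆ s`: `t'` sits on top of `s` — every prime factor of `s` is below every prime factor of `t'`
(so `t'` is a top segment of `t' s`). [folklore] -/
def OnTop (t' s : ℕ) : Prop := ∀ p ∈ t'.primeFactors, ∀ q ∈ s.primeFactors, q < p

/-- **Where two nested combinatorial sieves differ**: if `cond ⇒ cond'` and the squarefree `t` is kept by
`cond'` but not by `cond`, then `t = t' s` with `t'` on top of `s`, `t' ≠ 1`, `ν(t') ≡ par`, `cond' t'` and
`¬ cond t'`. [cite: IwaniecActaArith1980b, §5 p. 318 (classes C, D)] -/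
theorem exists_topSeg_of_predC_of_not_predC :
    ∀ {t : ℕ}, Squarefree t → predC par cond' t → ¬ predC par cond t →
      ∃ t' s : ℕ, t = t' * s ∧ OnTop t' s ∧ t' ≠ 1 ∧ t'.primeFactors.card % 2 = par % 2 ∧
        cond' t' ∧ ¬ cond t' := by
  intro t
  induction t using Nat.strong_induction_on with
  | _ t ih =>
    intro ht h' h
    by_cases h1 : t ≤ 1
    · exact absurd (predC_of_le_one h1) h
    have h1' : 1 < t := not_le.mp h1
    have ht1 : t ≠ 1 := by omega
    have ht0 : t ≠ 0 := ht.ne_zero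
    have hp := Nat.minFac_prime ht1
    rw [predC_iff h1'] at h' h
    have ht' : Squarefree (t / t.minFac) := ht.squarefree_of_dvd (Nat.div_dvd_of_dvd (Nat.minFac_dvd t))
    have hlt : t / t.minFac < t := Nat.div_lt_self (by omega) hp.one_lt
    by_cases hA : t.primeFactors.card % 2 = par % 2 ∧ ¬ cond t
    · refine ⟨t, 1, (mul_one t).symm, fun p _ q hq => by simp at hq, ht1, hA.1, h'.2 hA.1, hA.2⟩
    · have hB : ¬ predC par cond (t / t.minFac) := by
        intro hc; apply h; exact ⟨hc, fun hpar => by_contra fun hn => hA ⟨hpar, hn⟩⟩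
      obtain ⟨t', s', heq, htop, ht'1, hpar', hc', hnc⟩ := ih _ hlt ht' h'.1 hB
      refine ⟨t', s' * t.minFac, ?_, ?_, ht'1, hpar', hc', hnc⟩
      · rw [← mul_assoc, ← heq]; exact (div_minFac_mul (A := t)).symm
      · intro p hp' q hq
        have hs'0 : s' ≠ 0 := by
          intro h0; rw [h0, mul_zero] at heq; exact ht'.ne_zero heq
        rw [Nat.primeFactors_mul hs'0 hp.ne_zero, Finset.mem_union, hp.primeFactors,
          Finset.mem_singleton] at hq
        rcases hq with hq | rfl
        · exact htop p hp' q hq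
        · -- `q(t)` is below every prime factor of `t / q(t) ⊇ t'`
          have ht'dvd : t' ∣ t / t.minFac := ⟨s', heq⟩
          exact minFac_lt_of_mem_primeFactors_div ht ht1 (Nat.primeFactors_mono ht'dvd ht'.ne_zero hp')

/-- The set of BAD top segments: `t' ≠ 1`, `ν(t') ≡ par`, kept by `cond'`, rejected by `cond`. [folklore] -/
def badSeg (par : ℕ) (cond cond' : ℕ → Prop) (t' : ℕ) : Prop :=
  t' ≠ 1 ∧ t'.primeFactors.card % 2 = par % 2 ∧ cond' t' ∧ ¬ cond t'

/-- Monotonicity of `predC` in the condition, with the implication required on squarefree numbers only.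
[folklore] -/
theorem predC_mono_of_squarefree (hcc : ∀ d, Squarefree d → cond d → cond' d) :
    ∀ {d : ℕ}, Squarefree d → predC par cond d → predC par cond' d := by
  intro d
  induction d using Nat.strong_induction_on with
  | _ d ih =>
    intro hd h
    by_cases h1 : d ≤ 1
    · exact predC_of_le_one h1
    have h1' : 1 < d := not_le.mp h1
    rw [predC_iff h1'] at h ⊢
    have hlt : d / d.minFac < d := Nat.div_lt_self (by omega) (Nat.minFac_prime (by omega)).one_lt
    have hd' : Squarefree (d / d.minFac) := hd.squarefree_of_dvd (Nat.div_dvd_of_dvd (Nat.minFac_dvd d))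
    exact ⟨ih _ hlt hd' h.1, fun hpar => hcc d hd (h.2 hpar)⟩

open scoped Classical in
/-- **Iwaniec's (30), for the exact box weights**: for `cond ⇒ cond'` (on squarefree numbers), squarefree `P` and multiplicative
`g ≥ 0` on the divisors of `P`,
`|∑_{t ∣ P} μ(t) (χ'(t) − χ(t)) g(t)| ≤ (∑_{t' ∣ P bad} g(t')) · ∑_{s ∣ P} g(s)`.
[cite: IwaniecActaArith1980b, §5 (30) p. 318] -/
theorem abs_mainSum_indC_sub_le (hcc : ∀ d, Squarefree d → cond d → cond' d) {g : ArithmeticFunction ℝ}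
    (hg : g.IsMultiplicative) {P : ℕ} (hP : Squarefree P) (hg0 : ∀ d ∈ P.divisors, 0 ≤ g d) :
    |∑ t ∈ P.divisors, (μ t : ℝ) * (indC par cond' t - indC par cond t) * g t| ≤
      (∑ t ∈ P.divisors with badSeg par cond cond' t, g t) * ∑ s ∈ P.divisors, g s := by
  classical
  -- the terms vanish off the bad set `{t : χ'(t) = 1, χ(t) = 0}`
  set Bad : Finset ℕ := P.divisors.filter fun t => predC par cond' t ∧ ¬ predC par cond t with hBad
  have hvanish : ∀ t ∈ P.divisors, t ∉ Bad → (μ t : ℝ) * (indC par cond' t - indC par cond t) * g t = 0 := by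
    intro t ht hnot
    simp only [hBad, Finset.mem_filter, not_and, not_not] at hnot
    by_cases h' : predC par cond' t
    · rw [indC_of_predC h', indC_of_predC (hnot ht h'), sub_self, mul_zero, zero_mul]
    · have h : ¬ predC par cond t := fun hc =>
        h' (predC_mono_of_squarefree hcc (hP.squarefree_of_dvd (Nat.dvd_of_mem_divisors ht)) hc)
      rw [indC_of_not_predC h', indC_of_not_predC h, sub_self, mul_zero, zero_mul]
  have hsub : Bad ⊆ P.divisors := Finset.filter_subset _ _
  rw [← Finset.sum_subset hsub (fun t ht hnot => hvanish t ht hnot)]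
  -- on the bad set the term is `± g(t)`
  have hterm : ∀ t ∈ Bad, |(μ t : ℝ) * (indC par cond' t - indC par cond t) * g t| ≤ g t := by
    intro t ht
    rw [hBad, Finset.mem_filter] at ht
    rw [indC_of_predC ht.2.1, indC_of_not_predC ht.2.2, sub_zero, mul_one, abs_mul,
      abs_of_nonneg (hg0 t ht.1)]
    have hμ : |(μ t : ℝ)| ≤ 1 := by exact_mod_cast ArithmeticFunction.abs_moebius_le_one
    exact mul_le_of_le_one_left (hg0 t ht.1) hμ
  refine (Finset.abs_sum_le_sum_abs _ _).trans ((Finset.sum_le_sum hterm).trans ?_)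
  -- decompose each bad `t` as `t' s`
  have hdec : ∀ t ∈ Bad, ∃ x : ℕ × ℕ, t = x.1 * x.2 ∧ OnTop x.1 x.2 ∧ badSeg par cond cond' x.1 := by
    intro t ht
    rw [hBad, Finset.mem_filter] at ht
    obtain ⟨t', s, heq, htop, h1, hpar, hc', hnc⟩ := exists_topSeg_of_predC_of_not_predC
      (par := par) (cond := cond) (cond' := cond') (hP.squarefree_of_dvd (Nat.dvd_of_mem_divisors ht.1)) ht.2.1 ht.2.2
    exact ⟨(t', s), heq, htop, h1, hpar, hc', hnc⟩
  choose! dec hdec1 hdec2 hdec3 using hdec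
  set T : Finset (ℕ × ℕ) := (P.divisors.filter fun t => badSeg par cond cond' t) ×ˢ P.divisors with hT
  have hinj : Set.InjOn dec (Bad : Set ℕ) := by
    intro t₁ ht₁ t₂ ht₂ h
    rw [hdec1 t₁ ht₁, hdec1 t₂ ht₂, h]
  have hmaps : ∀ t ∈ Bad, dec t ∈ T := by
    intro t ht
    have htP : t ∣ P := Nat.dvd_of_mem_divisors (hsub ht)
    have hP0 := hP.ne_zero
    rw [hT, Finset.mem_product, Finset.mem_filter, Nat.mem_divisors, Nat.mem_divisors]
    refine ⟨⟨⟨?_, hP0⟩, hdec3 t ht⟩, ?_, hP0⟩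
    · exact (Dvd.intro _ (hdec1 t ht).symm).trans htP
    · exact (Dvd.intro_left _ (hdec1 t ht).symm).trans htP
  have hval : ∀ t ∈ Bad, g t = g (dec t).1 * g (dec t).2 := by
    intro t ht
    have hsq : Squarefree t := hP.squarefree_of_dvd (Nat.dvd_of_mem_divisors (hsub ht))
    conv_lhs => rw [hdec1 t ht]
    rw [hdec1 t ht] at hsq
    exact hg.map_mul_of_coprime (Nat.coprime_of_squarefree_mul hsq)
  calc ∑ t ∈ Bad, g t = ∑ t ∈ Bad, g (dec t).1 * g (dec t).2 := Finset.sum_congr rfl hval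
    _ = ∑ x ∈ Bad.image dec, g x.1 * g x.2 := (Finset.sum_image (f := fun x : ℕ × ℕ => g x.1 * g x.2) hinj).symm
    _ ≤ ∑ x ∈ T, g x.1 * g x.2 := by
        refine Finset.sum_le_sum_of_subset_of_nonneg (Finset.image_subset_iff.mpr hmaps) ?_
        intro x hx _
        rw [hT, Finset.mem_product, Finset.mem_filter] at hx
        exact mul_nonneg (hg0 _ hx.1.1) (hg0 _ hx.2)
    _ = (∑ t ∈ P.divisors with badSeg par cond cond' t, g t) * ∑ s ∈ P.divisors, g s := by
        rw [hT, Finset.sum_product, Finset.sum_mul_sum]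

/-- **A strip sum factors through the least prime**: if every `t'` in a set `S` of divisors `≠ 1` of the
squarefree `P` satisfies `Q (t'/q(t')) (q(t'))`, then for multiplicative `g ≥ 0`,
`∑_{t' ∈ S} g(t') ≤ ∑_{m ∣ P} g(m) ∑_{q ∣ P prime, Q m q} g(q)`. [folklore] -/
theorem sum_le_sum_mul_sum_minFac {g : ArithmeticFunction ℝ} (hg : g.IsMultiplicative) {P : ℕ}
    (hP : Squarefree P) (hg0 : ∀ d ∈ P.divisors, 0 ≤ g d) (S : Finset ℕ) (hS : S ⊆ P.divisors)
    (hS1 : ∀ t ∈ S, t ≠ 1) (Q : ℕ → ℕ → Prop) [∀ m q, Decidable (Q m q)]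
    (hQ : ∀ t ∈ S, Q (t / t.minFac) t.minFac) :
    ∑ t ∈ S, g t ≤ ∑ m ∈ P.divisors, g m * ∑ q ∈ P.primeFactors with Q m q, g q := by
  classical
  set T : Finset (ℕ × ℕ) := (P.divisors ×ˢ P.primeFactors).filter fun x => Q x.1 x.2 with hT
  set dec : ℕ → ℕ × ℕ := fun t => (t / t.minFac, t.minFac) with hdec
  have hinj : Set.InjOn dec (S : Set ℕ) := by
    intro t₁ _ t₂ _ h
    simp only [hdec, Prod.mk.injEq] at h
    rw [← Nat.div_mul_cancel (Nat.minFac_dvd t₁), ← Nat.div_mul_cancel (Nat.minFac_dvd t₂), h.1, h.2]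
  have hmaps : ∀ t ∈ S, dec t ∈ T := by
    intro t ht
    have htP : t ∣ P := Nat.dvd_of_mem_divisors (hS ht)
    have hP0 := hP.ne_zero
    have ht1 := hS1 t ht
    simp only [hT, hdec, Finset.mem_filter, Finset.mem_product, Nat.mem_divisors, Nat.mem_primeFactors]
    exact ⟨⟨⟨(Nat.div_dvd_of_dvd (Nat.minFac_dvd t)).trans htP, hP0⟩,
      ⟨Nat.minFac_prime ht1, (Nat.minFac_dvd t).trans htP, hP0⟩⟩, hQ t ht⟩
  have hval : ∀ t ∈ S, g t = g (dec t).1 * g (dec t).2 := by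
    intro t ht
    have ht1 := hS1 t ht
    have hsq : Squarefree t := hP.squarefree_of_dvd (Nat.dvd_of_mem_divisors (hS ht))
    simp only [hdec]
    conv_lhs => rw [← div_minFac_mul (A := t)]
    have hsq' : Squarefree (t / t.minFac * t.minFac) := by rw [div_minFac_mul]; exact hsq
    exact hg.map_mul_of_coprime (Nat.coprime_of_squarefree_mul hsq')
  have hT0 : ∀ x ∈ T, 0 ≤ g x.1 * g x.2 := by
    intro x hx
    simp only [hT, Finset.mem_filter, Finset.mem_product] at hx
    refine mul_nonneg (hg0 _ hx.1.1) (hg0 _ ?_)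
    exact Nat.mem_divisors.mpr ⟨Nat.dvd_of_mem_primeFactors hx.1.2, hP.ne_zero⟩
  calc ∑ t ∈ S, g t = ∑ t ∈ S, g (dec t).1 * g (dec t).2 := Finset.sum_congr rfl hval
    _ = ∑ x ∈ S.image dec, g x.1 * g x.2 := (Finset.sum_image (f := fun x : ℕ × ℕ => g x.1 * g x.2) hinj).symm
    _ ≤ ∑ x ∈ T, g x.1 * g x.2 :=
        Finset.sum_le_sum_of_subset_of_nonneg (Finset.image_subset_iff.mpr hmaps) fun x hx _ => hT0 x hx
    _ = ∑ m ∈ P.divisors, g m * ∑ q ∈ P.primeFactors with Q m q, g q := by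
        rw [hT, Finset.sum_filter, Finset.sum_product]
        refine Finset.sum_congr rfl fun m _ => ?_
        rw [Finset.sum_filter, Finset.mul_sum]
        refine Finset.sum_congr rfl fun q _ => ?_
        split_ifs <;> simp

/-- `∑_{d ∣ P} g(d) = ∏_{p ∣ P} (1 + g(p))` for squarefree `P` and multiplicative `g`. [folklore] -/
theorem sum_divisors_eq_prod_one_add {g : ArithmeticFunction ℝ} (hg : g.IsMultiplicative) {P : ℕ}
    (hP : Squarefree P) : ∑ d ∈ P.divisors, g d = ∏ p ∈ P.primeFactors, (1 + g p) :=
  (hg.prodPrimeFactors_one_add_of_squarefree hP).symm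

/-- `∑_{d ∣ P} g(d) ≤ ∏_{p ∣ P} (1 − g(p))⁻¹` (`0 ≤ g(p) < 1`; `1 + x ≤ (1 − x)⁻¹`). [folklore] -/
theorem sum_divisors_le_vprod_inv {g : ArithmeticFunction ℝ} (hg : g.IsMultiplicative) {P : ℕ}
    (hP : Squarefree P) (h01 : ∀ p ∈ P.primeFactors, 0 ≤ g p ∧ g p < 1) :
    ∑ d ∈ P.divisors, g d ≤ (vprod g P)⁻¹ := by
  rw [sum_divisors_eq_prod_one_add hg hP, vprod, ← Finset.prod_inv_distrib]
  refine Finset.prod_le_prod (fun p hp => by linarith [(h01 p hp).1]) fun p hp => ?_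
  obtain ⟨h0, h1⟩ := h01 p hp
  rw [le_inv_comm₀ (by linarith) (by linarith), ← one_div, le_div_iff₀ (by linarith)]
  nlinarith

/-- **Prime sums from products**: `∑_{p ∈ T} g(p) ≤ log ∏_{p ∈ T} (1 − g(p))⁻¹` for `0 ≤ g(p) < 1`
(`x ≤ −log(1 − x)`). [folklore] -/
theorem sum_le_log_prod_inv {g : ArithmeticFunction ℝ} (T : Finset ℕ) (h01 : ∀ p ∈ T, 0 ≤ g p ∧ g p < 1) :
    ∑ p ∈ T, g p ≤ Real.log (∏ p ∈ T, (1 - g p)⁻¹) := by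
  rw [Real.log_prod (s := T) (f := fun p => (1 - g p)⁻¹) fun p hp => (inv_pos.mpr (by linarith [(h01 p hp).2])).ne']
  refine Finset.sum_le_sum fun p hp => ?_
  obtain ⟨h0, h1⟩ := h01 p hp
  rw [Real.log_inv]
  have := Real.log_le_sub_one_of_pos (by linarith : 0 < 1 - g p)
  linarith

/-- **Prime sums under Iwaniec's condition (1)**: if `∏_{w ≤ p < z'} (1 − g(p))⁻¹ ≤ (log z'/log w)(1 + K/log w)`
(`2 ≤ w < z'`, `K ≥ 0`) and `0 ≤ g < 1` on the primes, then
`∑_{w ≤ p < z'} g(p) ≤ (log z' − log w + K)/log w`. [cite: IwaniecActaArith1980b, §5 p. 319] -/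
theorem sum_primes_Ico_le {g : ArithmeticFunction ℝ} {K : ℝ} (hK : 0 ≤ K)
    (h1 : ∀ w z : ℝ, 2 ≤ w → w < z →
      ∏ p ∈ (Nat.primesBelow ⌈z⌉₊).filter (fun p : ℕ => w ≤ (p : ℝ)), (1 - g p)⁻¹ ≤
        Real.log z / Real.log w * (1 + K / Real.log w))
    (h01 : ∀ p : ℕ, p.Prime → 0 ≤ g p ∧ g p < 1) {w z' : ℝ} (hw : 2 ≤ w) (hwz : w < z') :
    ∑ p ∈ (Nat.primesBelow ⌈z'⌉₊).filter (fun p : ℕ => w ≤ (p : ℝ)), g p ≤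
      (Real.log z' - Real.log w + K) / Real.log w := by
  have hlogw : 0 < Real.log w := Real.log_pos (by linarith)
  have hlogz : 0 < Real.log z' := Real.log_pos (by linarith)
  have hwz' : Real.log w < Real.log z' := Real.log_lt_log (by linarith) hwz
  have h01' : ∀ p ∈ (Nat.primesBelow ⌈z'⌉₊).filter (fun p : ℕ => w ≤ (p : ℝ)), 0 ≤ g p ∧ g p < 1 :=
    fun p hp => h01 p (Nat.prime_of_mem_primesBelow (Finset.mem_filter.mp hp).1)
  refine (sum_le_log_prod_inv _ h01').trans ?_
  have hprod_pos : 0 < ∏ p ∈ (Nat.primesBelow ⌈z'⌉₊).filter (fun p : ℕ => w ≤ (p : ℝ)), (1 - g p)⁻¹ :=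
    Finset.prod_pos fun p hp => inv_pos.mpr (by linarith [(h01' p hp).2])
  refine (Real.log_le_log hprod_pos (h1 w z' hw hwz)).trans ?_
  have hA : 0 < Real.log z' / Real.log w := div_pos hlogz hlogw
  have hB : 0 < 1 + K / Real.log w := by positivity
  rw [Real.log_mul hA.ne' hB.ne']
  have h2 : Real.log (Real.log z' / Real.log w) ≤ (Real.log z' - Real.log w) / Real.log w := by
    have := Real.log_le_sub_one_of_pos hA
    rw [div_sub_one hlogw.ne'] at this
    exact this
  have h3 : Real.log (1 + K / Real.log w) ≤ K / Real.log w := by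
    have := Real.log_le_sub_one_of_pos hB
    linarith
  rw [add_div]
  exact add_le_add h2 h3

/-- Rosser's indicator is the `predC`-indicator of Rosser's condition. [folklore] -/
theorem ind_eq_indC (par : ℕ) (β D' : ℝ) (t : ℕ) :
    ind par β D' t = indC par (fun d => (d : ℝ) * (d.minFac : ℝ) ^ β < D') t := by
  by_cases h : pred par β D' t
  · rw [ind_of_pred h, indC_of_predC (pred_iff_predC.mp h)]
  · rw [ind_of_not_pred h, indC_of_not_predC (fun h' => h (pred_iff_predC.mpr h'))]

end BetaSieve

namespace Iwaniec1980b

variable {D ε η : ℝ} (hD : 1 < D) (hε : 0 < ε) (hη : 0 < η)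
include hD hε hη

/-- **A bad top segment lies in the strip** `D^{1/(1+η)} ≤ t' q(t')²` (and `t' q(t')² < D`): for
squarefree `t' ≠ 1` with prime factors `≥ u`, if Rosser's condition `t' q(t')² < D` holds but the box
condition fails, then `(t' q(t')²)^{1+η} ≥ D` (since `D̂(p) ≤ p^{1+η}`).
[cite: IwaniecActaArith1980b, §5 p. 318 (class C)] -/
theorem rpow_ge_of_bad {t : ℕ} (ht : Squarefree t) (h1 : t ≠ 1)
    (hu : ∀ p ∈ t.primeFactors, grid D ε η 0 ≤ (p : ℝ))
    (hbad : ¬ condK (D := D) (ε := ε) (η := η) (pat hD hε hη t)) :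
    D ≤ ((t : ℝ) * (t.minFac : ℝ) ^ 2) ^ (1 + η) := by
  have ht0 := ht.ne_zero
  have hη1 : 0 ≤ 1 + η := by linarith
  unfold condK at hbad
  rw [not_lt, mmin_pat hD hε hη h1 ht0] at hbad
  refine hbad.trans ?_
  -- `bprod (pat t) ≤ t^{1+η}` and `D̂(q)² ≤ (q^{1+η})²`
  have hq : t.minFac ∈ t.primeFactors :=
    Nat.mem_primeFactors.mpr ⟨Nat.minFac_prime h1, Nat.minFac_dvd t, ht0⟩
  have hA : bprod (D := D) (ε := ε) (η := η) (pat hD hε hη t) ≤ (t : ℝ) ^ (1 + η) := by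
    rw [← prod_dhat_eq_bprod hD hε hη]
    conv_rhs => rw [← Nat.prod_primeFactors_of_squarefree ht]
    push_cast
    rw [← Real.finsetProd_rpow _ _ (fun p _ => Nat.cast_nonneg p)]
    exact Finset.prod_le_prod (fun p _ => (grid_pos (by linarith) _).le) fun p hp => dhat_le_rpow hD hε hη (hu p hp)
  have hB : grid D ε η (boxIdx hD hε hη t.minFac + 1) ≤ (t.minFac : ℝ) ^ (1 + η) := dhat_le_rpow hD hε hη (hu _ hq)
  have hB0 : 0 ≤ grid D ε η (boxIdx hD hε hη t.minFac + 1) := (grid_pos (by linarith) _).le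
  calc bprod (D := D) (ε := ε) (η := η) (pat hD hε hη t) * grid D ε η (boxIdx hD hε hη t.minFac + 1) ^ 2
      ≤ (t : ℝ) ^ (1 + η) * ((t.minFac : ℝ) ^ (1 + η)) ^ 2 :=
        mul_le_mul hA (pow_le_pow_left₀ hB0 hB 2) (sq_nonneg _) (Real.rpow_nonneg (Nat.cast_nonneg _) _)
    _ = ((t : ℝ) * (t.minFac : ℝ) ^ 2) ^ (1 + η) := by
        rw [Real.mul_rpow (Nat.cast_nonneg _) (sq_nonneg _), ← Real.rpow_natCast ((t.minFac : ℝ) ^ (1 + η)) 2,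
          ← Real.rpow_mul (Nat.cast_nonneg _), ← Real.rpow_natCast (t.minFac : ℝ) 2,
          ← Real.rpow_mul (Nat.cast_nonneg _)]
        congr 2; push_cast; ring

omit hε in
/-- **The inner prime sum over a strip** (Iwaniec (33), the sum over `m₁ ≤ p³ < m₂`): under condition (1)
with `0 ≤ g < 1`, for `u = D₀ ≥ 2` and any `m`, the primes `q ≥ u` with `D ≤ (m q³)^{1+η}` and `m q³ < D`
have `∑ g(q) ≤ (η log D/(3(1+η)) + K)/log u`. [cite: IwaniecActaArith1980b, §5 (33) p. 319] -/
theorem sum_primes_strip_le {g : ArithmeticFunction ℝ} {K : ℝ} (hK : 0 ≤ K)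
    (h1 : ∀ w z : ℝ, 2 ≤ w → w < z →
      ∏ p ∈ (Nat.primesBelow ⌈z⌉₊).filter (fun p : ℕ => w ≤ (p : ℝ)), (1 - g p)⁻¹ ≤
        Real.log z / Real.log w * (1 + K / Real.log w))
    (h01 : ∀ p : ℕ, p.Prime → 0 ≤ g p ∧ g p < 1) (hu2 : 2 ≤ grid D ε η 0)
    (T : Finset ℕ) (hT : ∀ q ∈ T, q.Prime ∧ grid D ε η 0 ≤ (q : ℝ)) {m : ℕ} (hm : 0 < m)
    (hQ : ∀ q ∈ T, D ≤ ((m : ℝ) * (q : ℝ) ^ 3) ^ (1 + η) ∧ (m : ℝ) * (q : ℝ) ^ 3 < D) :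
    ∑ q ∈ T, g q ≤ (η / (3 * (1 + η)) * Real.log D + K) / Real.log (grid D ε η 0) := by
  set u := grid D ε η 0 with hu
  have hD0 : 0 < D := by linarith
  have hη1 : 0 < 1 + η := by linarith
  have hlogu : 0 < Real.log u := Real.log_pos (by linarith)
  have hlogD : 0 < Real.log D := Real.log_pos hD
  have hnum : 0 ≤ η / (3 * (1 + η)) * Real.log D + K := by positivity
  rcases T.eq_empty_or_nonempty with hT0 | ⟨q₀, hq₀⟩
  · rw [hT0, Finset.sum_empty]; exact div_nonneg hnum hlogu.le
  -- the window `[a, a ρ)` with `a = (D^{1/(1+η)}/m)^{1/3}`, `ρ = D^{η/(3(1+η))}`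
  set a : ℝ := (D ^ (1 / (1 + η)) / m) ^ (1 / 3 : ℝ) with ha
  set ρ : ℝ := D ^ (η / (3 * (1 + η))) with hρ
  have hm0 : (0 : ℝ) < m := by exact_mod_cast hm
  have ha0 : 0 < a := Real.rpow_pos_of_pos (div_pos (Real.rpow_pos_of_pos hD0 _) hm0) _
  have hρ1 : 1 < ρ := Real.one_lt_rpow hD (by positivity)
  have hlogρ : Real.log ρ = η / (3 * (1 + η)) * Real.log D := by rw [hρ, Real.log_rpow hD0]
  -- every `q ∈ T` lies in `[a, a ρ)`
  have hwin : ∀ q ∈ T, a ≤ (q : ℝ) ∧ (q : ℝ) < a * ρ := by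
    intro q hq
    obtain ⟨hQ1, hQ2⟩ := hQ q hq
    have hq0 : (0 : ℝ) < q := by exact_mod_cast (hT q hq).1.pos
    have hq3 : (0 : ℝ) < (q : ℝ) ^ 3 := by positivity
    constructor
    · -- `D ≤ (m q³)^{1+η}` ⇒ `D^{1/(1+η)}/m ≤ q³` ⇒ `a ≤ q`
      have h2 : D ^ (1 / (1 + η)) ≤ (m : ℝ) * (q : ℝ) ^ 3 := by
        have := Real.rpow_le_rpow hD0.le hQ1 (by positivity : (0:ℝ) ≤ 1 / (1 + η))
        rwa [← Real.rpow_mul (by positivity), mul_one_div_cancel hη1.ne', Real.rpow_one] at this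
      have h3 : D ^ (1 / (1 + η)) / m ≤ (q : ℝ) ^ 3 := by rw [div_le_iff₀' hm0]; exact h2
      have h4 := Real.rpow_le_rpow (div_pos (Real.rpow_pos_of_pos hD0 _) hm0).le h3 (by norm_num : (0:ℝ) ≤ 1 / 3)
      rw [← ha] at h4
      refine h4.trans (le_of_eq ?_)
      rw [show ((q : ℝ) ^ 3) = (q : ℝ) ^ (3 : ℝ) by norm_cast, ← Real.rpow_mul hq0.le]; norm_num
    · -- `m q³ < D` ⇒ `q < (D/m)^{1/3} = a ρ`
      have h3 : (q : ℝ) ^ 3 < D / m := by rw [lt_div_iff₀' hm0]; exact hQ2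
      have h4 : (q : ℝ) < (D / m) ^ (1 / 3 : ℝ) := by
        have := Real.rpow_lt_rpow hq3.le h3 (by norm_num : (0:ℝ) < 1 / 3)
        rwa [show ((q : ℝ) ^ 3) = (q : ℝ) ^ (3 : ℝ) by norm_cast, ← Real.rpow_mul hq0.le,
          show (3 : ℝ) * (1 / 3) = 1 by norm_num, Real.rpow_one] at this
      refine h4.trans_le (le_of_eq ?_)
      have hid : (D ^ (1 / (1 + η)) / m) ^ (1 / 3 : ℝ) * D ^ (η / (3 * (1 + η))) = (D / m) ^ (1 / 3 : ℝ) := by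
        rw [Real.div_rpow (Real.rpow_nonneg hD0.le _) hm0.le, Real.div_rpow hD0.le hm0.le,
          ← Real.rpow_mul hD0.le, div_mul_eq_mul_div, ← Real.rpow_add hD0]
        congr 2
        field_simp
      rw [ha, hρ, hid]
  -- the primes of `T` lie in `[a', a' ρ)`, `a' = max a u ≥ 2`
  set a' := max a u with ha'
  have ha'2 : 2 ≤ a' := le_trans hu2 (le_max_right _ _)
  have ha'ρ : a' < a' * ρ := lt_mul_of_one_lt_right (by linarith) hρ1
  have hsub : T ⊆ (Nat.primesBelow ⌈a' * ρ⌉₊).filter (fun p : ℕ => a' ≤ (p : ℝ)) := by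
    intro q hq
    obtain ⟨hqa, hqb⟩ := hwin q hq
    rw [Finset.mem_filter, Nat.mem_primesBelow, Nat.lt_ceil]
    refine ⟨⟨hqb.trans_le ?_, (hT q hq).1⟩, max_le hqa (hT q hq).2⟩
    exact mul_le_mul_of_nonneg_right (le_max_left _ _) (by linarith)
  have h01' : ∀ p ∈ (Nat.primesBelow ⌈a' * ρ⌉₊).filter (fun p : ℕ => a' ≤ (p : ℝ)), 0 ≤ g p :=
    fun p hp => (h01 p (Nat.prime_of_mem_primesBelow (Finset.mem_filter.mp hp).1)).1
  refine (Finset.sum_le_sum_of_subset_of_nonneg hsub fun p hp _ => h01' p hp).trans ?_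
  refine (BetaSieve.sum_primes_Ico_le hK h1 h01 ha'2 ha'ρ).trans ?_
  have hloga' : Real.log u ≤ Real.log a' := Real.log_le_log (by linarith) (le_max_right _ _)
  have hloga'0 : 0 < Real.log a' := lt_of_lt_of_le hlogu hloga'
  rw [Real.log_mul (by linarith) (by linarith), hlogρ]
  rw [show Real.log a' + η / (3 * (1 + η)) * Real.log D - Real.log a' + K = η / (3 * (1 + η)) * Real.log D + K by ring]
  exact div_le_div_of_nonneg_left hnum hlogu hloga'

/-- **Iwaniec's (30)+(33) for the exact box weights**: with `u = D₀ ≥ 2`, `P = P(z, u)` the product of the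
primes in `[u, z)`, condition (1) and `0 ≤ g < 1` on the primes (`g` multiplicative),
`|∑_{t ∣ P} μ(t) (χ_Rosser(t) − χ̃_box(t)) g(t)| ≤ ((η log D/(3(1+η)) + K)/log u) · (∑_{d ∣ P} g(d))²`.
[cite: IwaniecActaArith1980b, §5 (30), (33) pp. 318–319] -/
theorem abs_rosserMain_sub_boxMain_le {g : ArithmeticFunction ℝ} (hg : g.IsMultiplicative) {K : ℝ} (hK : 0 ≤ K)
    (h1 : ∀ w z : ℝ, 2 ≤ w → w < z →
      ∏ p ∈ (Nat.primesBelow ⌈z⌉₊).filter (fun p : ℕ => w ≤ (p : ℝ)), (1 - g p)⁻¹ ≤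
        Real.log z / Real.log w * (1 + K / Real.log w))
    (h01 : ∀ p : ℕ, p.Prime → 0 ≤ g p ∧ g p < 1) (hu2 : 2 ≤ grid D ε η 0) (par : ℕ) (z : ℝ) :
    |∑ t ∈ (primesProdIco (grid D ε η 0) z).divisors,
        (μ t : ℝ) * (BetaSieve.ind par 2 D t -
          BetaSieve.indC par (fun t => condK (D := D) (ε := ε) (η := η) (pat hD hε hη t)) t) * g t| ≤
      (η / (3 * (1 + η)) * Real.log D + K) / Real.log (grid D ε η 0) *
        (∑ d ∈ (primesProdIco (grid D ε η 0) z).divisors, g d) ^ 2 := by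
  classical
  set u := grid D ε η 0 with hu
  set P := primesProdIco u z with hP
  have hPsq : Squarefree P := squarefree_primesProdIco u z
  have hg0 : ∀ d ∈ P.divisors, 0 ≤ g d := by
    intro d hd
    have hdsq := hPsq.squarefree_of_dvd (Nat.dvd_of_mem_divisors hd)
    rw [← Nat.prod_primeFactors_of_squarefree hdsq, hg.map_prod_of_subset_primeFactors _ _ Finset.Subset.rfl]
    exact Finset.prod_nonneg fun p hp => (h01 p (Nat.prime_of_mem_primeFactors hp)).1
  have hW0 : 0 ≤ ∑ d ∈ P.divisors, g d := Finset.sum_nonneg hg0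
  simp_rw [BetaSieve.ind_eq_indC par 2 D]
  -- `cond = box ⇒ cond' = Rosser` on squarefree numbers
  have hcc : ∀ d, Squarefree d → condK (D := D) (ε := ε) (η := η) (pat hD hε hη d) →
      (d : ℝ) * (d.minFac : ℝ) ^ (2 : ℝ) < D := by
    intro d hd hc
    by_cases h1 : d = 1
    · subst h1; simp; linarith
    · exact rosser_of_condK hD hε hη hd h1 hc
  refine (BetaSieve.abs_mainSum_indC_sub_le (par := par) hcc hg hPsq hg0).trans ?_
  rw [sq, ← mul_assoc]
  refine mul_le_mul_of_nonneg_right ?_ hW0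
  -- the bad segments lie in the strip; factor through the least prime
  set Q : ℕ → ℕ → Prop := fun m q => D ≤ ((m : ℝ) * (q : ℝ) ^ 3) ^ (1 + η) ∧ (m : ℝ) * (q : ℝ) ^ 3 < D with hQ
  set S := P.divisors.filter fun t => BetaSieve.badSeg par
    (fun t => condK (D := D) (ε := ε) (η := η) (pat hD hε hη t)) (fun d => (d : ℝ) * (d.minFac : ℝ) ^ (2 : ℝ) < D) t with hS
  have hS1 : ∀ t ∈ S, t ≠ 1 := fun t ht => (Finset.mem_filter.mp ht).2.1
  have hu_of_dvd : ∀ t, t ∣ P → ∀ p ∈ t.primeFactors, u ≤ (p : ℝ) := by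
    intro t ht p hp
    exact le_of_mem_primeFactors_primesProdIco (Nat.primeFactors_mono ht hPsq.ne_zero hp)
  have hQS : ∀ t ∈ S, Q (t / t.minFac) t.minFac := by
    intro t ht
    rw [hS, Finset.mem_filter] at ht
    obtain ⟨htP, ht1, -, hc', hnc⟩ := ht
    have htP' := Nat.dvd_of_mem_divisors htP
    have htsq := hPsq.squarefree_of_dvd htP'
    have hkey : ((t / t.minFac : ℕ) : ℝ) * (t.minFac : ℝ) ^ 3 = (t : ℝ) * (t.minFac : ℝ) ^ 2 := by
      have : (t / t.minFac : ℕ) * t.minFac = t := Nat.div_mul_cancel (Nat.minFac_dvd t)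
      calc ((t / t.minFac : ℕ) : ℝ) * (t.minFac : ℝ) ^ 3
          = (((t / t.minFac : ℕ) * t.minFac : ℕ) : ℝ) * (t.minFac : ℝ) ^ 2 := by push_cast; ring
        _ = (t : ℝ) * (t.minFac : ℝ) ^ 2 := by rw [this]
    simp only [hQ, hkey]
    constructor
    · exact rpow_ge_of_bad hD hε hη htsq ht1 (hu_of_dvd t htP') hnc
    · have := hc'; rwa [Real.rpow_two] at this
  refine (BetaSieve.sum_le_sum_mul_sum_minFac hg hPsq hg0 S (Finset.filter_subset _ _) hS1 Q hQS).trans ?_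
  rw [Finset.mul_sum]
  refine Finset.sum_le_sum fun m hm => ?_
  have hm0 : 0 < m := Nat.pos_of_mem_divisors hm
  have hT : ∀ q ∈ P.primeFactors.filter (fun q => Q m q), q.Prime ∧ u ≤ (q : ℝ) := by
    intro q hq
    rw [Finset.mem_filter] at hq
    exact ⟨Nat.prime_of_mem_primeFactors hq.1, le_of_mem_primeFactors_primesProdIco hq.1⟩
  have hQT : ∀ q ∈ P.primeFactors.filter (fun q => Q m q),
      D ≤ ((m : ℝ) * (q : ℝ) ^ 3) ^ (1 + η) ∧ (m : ℝ) * (q : ℝ) ^ 3 < D :=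
    fun q hq => (Finset.mem_filter.mp hq).2
  have hinner := sum_primes_strip_le hD hη hK h1 h01 hu2 _ hT hm0 hQT
  calc g m * ∑ q ∈ P.primeFactors with Q m q, g q
      ≤ g m * ((η / (3 * (1 + η)) * Real.log D + K) / Real.log u) := mul_le_mul_of_nonneg_left hinner (hg0 m hm)
    _ = (η / (3 * (1 + η)) * Real.log D + K) / Real.log u * g m := mul_comm _ _

end Iwaniec1980b

end Literature.NumberTheory.Sieve

end
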